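import Mathlib
import Summits.Ventures.HodgeRepro.Tier4.Common.TargetData
import Summits.Ventures.HodgeRepro.Tier4.Common.TargetCalculus
import Summits.Ventures.HodgeRepro.Tier4.Common.TargetBall

/-!
# Tier4/Common/AutForms — the holomorphic forms of `X_{Γ′}` on the target's own objects: automorphic cotangent
fields and `2`-form coefficients on the ball, the corner forms, the wedge, the pairing over a domain

Blind re-derivation cell `pub-hodge-repro`, Tier 4 (README §9–§10), seat t4-typer-1 (gen 0).  Target tree path
`lean/Summits/Ventures/HodgeRepro/Tier4/Common/AutForms.lean`.  Imports `TargetData` (typer-1: the datum `d` of the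
frozen target, `d.act γ`), `TargetCalculus` (typer-2: `pd`, `jacDet`, `jacDetMap`, `pd_comp`, `pd_add_const`,
`fderiv_apply_eq_sum_pd`) and `TargetBall` (typer-2: `actM_mem_ball`, `differentiableOn_actM`, `toBallMat_J`,
`complexConj_intertwines`).

WHAT IS DEFINED (lead's ruling S12038 (R1): objects DEFINED, not parametrised).  A `1`-form on the cover
`X_{Γ′} = Γ′\𝔹²` is a cotangent field `F = F₀ dz₀ + F₁ dz₁` on the ball (zero outside it) invariant under the
pull-back along every `φ = d.act γ`, `γ ∈ Γ′`: `(φ^*F)(z) = (Dφ(z))ᵀ F(φ z) = F(z)` (`IsAutForm1`); a `2`-form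
`h dz₀ ∧ dz₁` is an `h` (zero outside the ball) with `(φ^*h)(z) = h(φ z) · det Dφ(z) = h(z)` (`IsAutForm2`).  These
are ℂ-submodules (`autForms1`, `autForms2`).  REGULARITY IS KEPT SEPARATE: Mathlib proves «holomorphic ⟹ analytic»
for functions of ONE complex variable only (`DifferentiableOn.analyticOnNhd`, domain `ℂ`); that the gradient of a
ℂ-differentiable map on an open set of `ℂ²` is again holomorphic (Osgood / Hartogs, textbook) is NOT in Mathlib, so
holomorphy of the corner FIELDS cannot be derived from `IsAlbaneseLift`'s `DifferentiableOn ℂ a ball` here — the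
predicates `IsHolo1` / `IsHolo2` name it, and it enters the residuals of the realisation, never silently.  The pointwise wedge of two `1`-forms is `wedgeField F G z = F₀G₁ − F₁G₀` (the sealed `wedge`); the pairing of
two `2`-form coefficients over a domain `D` is `pairing2 D h k = ∫_D h · conj k` (the target's own integrand).  The
corner forms (the gradients of the coordinates of the Albanese lifts) are `Tier4/Common/CornerForms.lean`.

WHAT IS PROVED.  `pullField_grad`: the pull-back of a gradient is the gradient of the composite (chain rule);
`wedge_transpose_mulVec`: `(Mᵀu) ∧ (Mᵀv) = det M · (u ∧ v)`; `wedgeField_isAutForm2`: the wedge of two invariant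
`1`-forms is an invariant `2`-form; the ball is open and convex, `Γ` acts on it holomorphically
(`act_mem_ball`, `differentiableOn_act`, through typer-2's `toBallMat_J`); `pairing2_conj`: the pairing is
hermitian, and it is linear / conjugate-linear.  NOT here: positivity of the pairing and finite-dimensionality of the automorphic forms
(the textbook residuals (T1), (T2) of the announcement S12046; `ConcreteRealisation.lean`).

Nothing here says anything about the status of the Hodge conjecture for CM abelian varieties, which is NOT proved
(HC_CM is NOT proved by anyone in this repository).
-/

set_option autoImplicit false

noncomputable section

open Matrix MeasureTheory NumberField
open scoped ComplexConjugate ComplexOrder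

namespace Summit.Ventures.HodgeRepro.Tier4

/-! ## The Jacobian matrix, the pull-backs, the gradient -/

/-- The Jacobian matrix `(∂φ_j/∂z_k)_{j,k}` of a self-map `φ` of `ℂ²` at `z`. -/
def jacMat (φ : (Fin 2 → ℂ) → (Fin 2 → ℂ)) (z : Fin 2 → ℂ) : Matrix (Fin 2) (Fin 2) ℂ :=
  fun j k => pd k (fun w => φ w j) z

/-- `det (jacMat φ z) = jacDetMap φ z`. -/
theorem det_jacMat (φ : (Fin 2 → ℂ) → (Fin 2 → ℂ)) (z : Fin 2 → ℂ) : (jacMat φ z).det = jacDetMap φ z := by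
  rw [Matrix.det_fin_two]
  simp [jacMat, jacDetMap, wedge]

/-- The pull-back `(φ^*F)(z) = (Dφ(z))ᵀ F(φ z)` of a cotangent field along `φ`. -/
def pullField (φ : (Fin 2 → ℂ) → (Fin 2 → ℂ)) (F : (Fin 2 → ℂ) → (Fin 2 → ℂ)) (z : Fin 2 → ℂ) : Fin 2 → ℂ :=
  (jacMat φ z)ᵀ *ᵥ F (φ z)

/-- The pull-back `(φ^*h)(z) = h(φ z) · det Dφ(z)` of a `2`-form coefficient along `φ`. -/
def pullCoeff (φ : (Fin 2 → ℂ) → (Fin 2 → ℂ)) (h : (Fin 2 → ℂ) → ℂ) (z : Fin 2 → ℂ) : ℂ :=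
  h (φ z) * jacDetMap φ z

/-- The gradient `(∂₀u, ∂₁u)` of a function on `ℂ²` — the coefficients of `du`. -/
def grad (u : (Fin 2 → ℂ) → ℂ) (z : Fin 2 → ℂ) : Fin 2 → ℂ := fun k => pd k u z

/-- The pointwise wedge `F ∧ G = F₀G₁ − F₁G₀` of two cotangent fields (the sealed `wedge`). -/
def wedgeField (F G : (Fin 2 → ℂ) → (Fin 2 → ℂ)) (z : Fin 2 → ℂ) : ℂ := wedge (F z) (G z)

/-- `jacDet u v = wedgeField (grad u) (grad v)`. -/
theorem jacDet_eq_wedgeField_grad (u v : (Fin 2 → ℂ) → ℂ) : jacDet u v = wedgeField (grad u) (grad v) := by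
  funext z
  rfl

/-- The pull-back is linear in the field: additivity. -/
theorem pullField_add (φ : (Fin 2 → ℂ) → (Fin 2 → ℂ)) (F G : (Fin 2 → ℂ) → (Fin 2 → ℂ)) :
    pullField φ (F + G) = pullField φ F + pullField φ G := by
  funext z
  simp [pullField, Matrix.mulVec_add]

/-- The pull-back is linear in the field: homogeneity. -/
theorem pullField_smul (φ : (Fin 2 → ℂ) → (Fin 2 → ℂ)) (c : ℂ) (F : (Fin 2 → ℂ) → (Fin 2 → ℂ)) :
    pullField φ (c • F) = c • pullField φ F := by
  funext z
  simp [pullField, Matrix.mulVec_smul]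

/-- The pull-back of the zero field is zero. -/
theorem pullField_zero (φ : (Fin 2 → ℂ) → (Fin 2 → ℂ)) : pullField φ (0 : (Fin 2 → ℂ) → (Fin 2 → ℂ)) = 0 := by
  funext z
  simp [pullField]

/-- **The chain rule for gradients**: `φ^*(grad u) = grad (u ∘ φ)` at a point where `u` is differentiable at `φ z`
and `φ` at `z`. -/
theorem pullField_grad {u : (Fin 2 → ℂ) → ℂ} {φ : (Fin 2 → ℂ) → (Fin 2 → ℂ)} {z : Fin 2 → ℂ}
    (hu : DifferentiableAt ℂ u (φ z)) (hφ : DifferentiableAt ℂ φ z) :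
    pullField φ (grad u) z = grad (u ∘ φ) z := by
  funext k
  simp only [pullField, grad, Matrix.mulVec, Matrix.transpose_apply, dotProduct, jacMat]
  rw [pd_comp k hu hφ]
  refine Finset.sum_congr rfl fun j _ => ?_
  ring

/-- **`(Mᵀu) ∧ (Mᵀv) = det M · (u ∧ v)`** for a `2 × 2` matrix `M`. -/
theorem wedge_transpose_mulVec (M : Matrix (Fin 2) (Fin 2) ℂ) (u v : Fin 2 → ℂ) :
    wedge (Mᵀ *ᵥ u) (Mᵀ *ᵥ v) = M.det * wedge u v := by
  simp only [wedge, Matrix.mulVec, Matrix.transpose_apply, dotProduct, Fin.sum_univ_two, Matrix.det_fin_two]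
  ring

/-- The wedge of pull-backs is the pull-back of the wedge: `(φ^*F) ∧ (φ^*G) = φ^*(F ∧ G)`. -/
theorem wedgeField_pullField (φ : (Fin 2 → ℂ) → (Fin 2 → ℂ)) (F G : (Fin 2 → ℂ) → (Fin 2 → ℂ)) (z : Fin 2 → ℂ) :
    wedgeField (pullField φ F) (pullField φ G) z = pullCoeff φ (wedgeField F G) z := by
  simp only [wedgeField, pullField, pullCoeff]
  rw [wedge_transpose_mulVec, det_jacMat, mul_comm]

/-! ## Automorphic forms on the cover `X_{Γ′}` -/

namespace TargetData

variable {F E : Type} [Field F] [NumberField F] [IsGalois ℚ F] [IsCMField F]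
  [Field E] [NumberField E] [IsGalois ℚ E] [IsCMField E] (d : TargetData F E)

/-- **A `1`-form on `X_{Γ′}`**: a cotangent field on the ball, zero outside it, invariant under the pull-back along
the ball action of every `γ ∈ Γ′`. -/
def IsAutForm1 (Γ' : Set (Matrix (Fin 3) (Fin 3) E)) (G : (Fin 2 → ℂ) → (Fin 2 → ℂ)) : Prop :=
  (∀ z, z ∉ ball → G z = 0) ∧ ∀ γ ∈ Γ', ∀ z ∈ ball, pullField (d.act γ) G z = G z

/-- **A `2`-form on `X_{Γ′}`** (its coefficient on `dz₀ ∧ dz₁`): zero outside the ball, invariant under the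
pull-back along the ball action of every `γ ∈ Γ′`. -/
def IsAutForm2 (Γ' : Set (Matrix (Fin 3) (Fin 3) E)) (h : (Fin 2 → ℂ) → ℂ) : Prop :=
  (∀ z, z ∉ ball → h z = 0) ∧ ∀ γ ∈ Γ', ∀ z ∈ ball, pullCoeff (d.act γ) h z = h z

/-- A cotangent field is holomorphic on the ball (the regularity every `1`-form of `X_{Γ′}` has — textbook, see the
header). -/
def IsHolo1 (G : (Fin 2 → ℂ) → (Fin 2 → ℂ)) : Prop := DifferentiableOn ℂ G ball

/-- A `2`-form coefficient is holomorphic on the ball. -/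
def IsHolo2 (h : (Fin 2 → ℂ) → ℂ) : Prop := DifferentiableOn ℂ h ball

/-- The ℂ-submodule of holomorphic `1`-forms on `X_{Γ′}`. -/
def autForms1 (Γ' : Set (Matrix (Fin 3) (Fin 3) E)) : Submodule ℂ ((Fin 2 → ℂ) → (Fin 2 → ℂ)) where
  carrier := {G | d.IsAutForm1 Γ' G}
  add_mem' := by
    rintro G G' ⟨hG, hG'⟩ ⟨hH, hH'⟩
    refine ⟨fun z hz => by simp [hG z hz, hH z hz], fun γ hγ z hz => ?_⟩
    rw [pullField_add, Pi.add_apply, hG' γ hγ z hz, hH' γ hγ z hz]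
    rfl
  zero_mem' := ⟨fun _ _ => rfl, fun γ _ z _ => by rw [pullField_zero]⟩
  smul_mem' := by
    rintro c G ⟨hG, hG'⟩
    refine ⟨fun z hz => by simp [hG z hz], fun γ hγ z hz => ?_⟩
    rw [pullField_smul, Pi.smul_apply, hG' γ hγ z hz]
    rfl

/-- The ℂ-submodule of holomorphic `2`-forms on `X_{Γ′}`. -/
def autForms2 (Γ' : Set (Matrix (Fin 3) (Fin 3) E)) : Submodule ℂ ((Fin 2 → ℂ) → ℂ) where
  carrier := {h | d.IsAutForm2 Γ' h}
  add_mem' := by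
    rintro h h' ⟨hh, hh'⟩ ⟨hk, hk'⟩
    refine ⟨fun z hz => by simp [hh z hz, hk z hz], fun γ hγ z hz => ?_⟩
    simp only [pullCoeff, Pi.add_apply] at hh' hk' ⊢
    rw [add_mul, hh' γ hγ z hz, hk' γ hγ z hz]
  zero_mem' := ⟨fun _ _ => rfl, fun γ _ z _ => by simp [pullCoeff]⟩
  smul_mem' := by
    rintro c h ⟨hh, hh'⟩
    refine ⟨fun z hz => by simp [hh z hz], fun γ hγ z hz => ?_⟩
    simp only [pullCoeff, Pi.smul_apply, smul_eq_mul] at hh' ⊢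
    rw [mul_assoc, hh' γ hγ z hz]

/-- Membership in `autForms1` is `IsAutForm1`. -/
theorem mem_autForms1 (Γ' : Set (Matrix (Fin 3) (Fin 3) E)) (G : (Fin 2 → ℂ) → (Fin 2 → ℂ)) :
    G ∈ d.autForms1 Γ' ↔ d.IsAutForm1 Γ' G := Iff.rfl

/-- Membership in `autForms2` is `IsAutForm2`. -/
theorem mem_autForms2 (Γ' : Set (Matrix (Fin 3) (Fin 3) E)) (h : (Fin 2 → ℂ) → ℂ) :
    h ∈ d.autForms2 Γ' ↔ d.IsAutForm2 Γ' h := Iff.rfl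

/-- **The wedge of two `1`-forms on `X_{Γ′}` is a `2`-form on `X_{Γ′}`.** -/
theorem wedgeField_isAutForm2 (Γ' : Set (Matrix (Fin 3) (Fin 3) E)) {G G' : (Fin 2 → ℂ) → (Fin 2 → ℂ)}
    (hG : d.IsAutForm1 Γ' G) (hG' : d.IsAutForm1 Γ' G') : d.IsAutForm2 Γ' (wedgeField G G') := by
  refine ⟨fun z hz => ?_, fun γ hγ z hz => ?_⟩
  · simp [wedgeField, hG.1 z hz, wedge]
  · rw [← wedgeField_pullField]
    simp only [wedgeField]
    rw [hG.2 γ hγ z hz, hG'.2 γ hγ z hz]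

/-- The wedge of two holomorphic cotangent fields is holomorphic. -/
theorem isHolo2_wedgeField {G G' : (Fin 2 → ℂ) → (Fin 2 → ℂ)} (hG : IsHolo1 G) (hG' : IsHolo1 G') :
    IsHolo2 (wedgeField G G') := by
  have h0 : DifferentiableOn ℂ (fun z => G z 0) ball := fun z hz => (differentiableWithinAt_pi.1 (hG z hz)) 0
  have h1 : DifferentiableOn ℂ (fun z => G z 1) ball := fun z hz => (differentiableWithinAt_pi.1 (hG z hz)) 1
  have h0' : DifferentiableOn ℂ (fun z => G' z 0) ball := fun z hz => (differentiableWithinAt_pi.1 (hG' z hz)) 0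
  have h1' : DifferentiableOn ℂ (fun z => G' z 1) ball := fun z hz => (differentiableWithinAt_pi.1 (hG' z hz)) 1
  exact (h0.mul h1').sub (h1.mul h0')

end TargetData

end Summit.Ventures.HodgeRepro.Tier4

/-! ## The ball: open, convex; the action of `Γ` on it -/

namespace Summit.Ventures.HodgeRepro.Tier4

/-- `nsq` is continuous. -/
theorem continuous_nsq : Continuous nsq :=
  ((continuous_apply 0).norm.pow 2).add ((continuous_apply 1).norm.pow 2)

/-- The ball is open. -/
theorem isOpen_ball : IsOpen ball := isOpen_lt continuous_nsq continuous_const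

/-- `(a u + b v)² ≤ a u² + b v²` for `a + b = 1`, `a, b ≥ 0` (convexity of the square). -/
theorem sq_convex_combo {a b u v : ℝ} (ha : 0 ≤ a) (hb : 0 ≤ b) (hab : a + b = 1) :
    (a * u + b * v) ^ 2 ≤ a * u ^ 2 + b * v ^ 2 := by
  have h : a * u ^ 2 + b * v ^ 2 - (a * u + b * v) ^ 2 = a * b * (u - v) ^ 2 := by
    have hb' : b = 1 - a := by linarith
    subst hb'
    ring
  nlinarith [mul_nonneg (mul_nonneg ha hb) (sq_nonneg (u - v))]

/-- The ball is convex. -/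
theorem convex_ball : Convex ℝ ball := by
  intro x hx y hy a b ha hb hab
  simp only [ball, nsq, Set.mem_setOf_eq] at hx hy ⊢
  have key : ∀ i : Fin 2, ‖(a • x + b • y) i‖ ^ 2 ≤ a * ‖x i‖ ^ 2 + b * ‖y i‖ ^ 2 := by
    intro i
    have h1 : ‖(a • x + b • y) i‖ ≤ a * ‖x i‖ + b * ‖y i‖ := by
      simp only [Pi.add_apply, Pi.smul_apply]
      calc ‖a • x i + b • y i‖ ≤ ‖a • x i‖ + ‖b • y i‖ := norm_add_le _ _
        _ = a * ‖x i‖ + b * ‖y i‖ := by rw [norm_smul, norm_smul, Real.norm_of_nonneg ha, Real.norm_of_nonneg hb]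
    have h2 : ‖(a • x + b • y) i‖ ^ 2 ≤ (a * ‖x i‖ + b * ‖y i‖) ^ 2 :=
      pow_le_pow_left₀ (norm_nonneg _) h1 2
    exact h2.trans (sq_convex_combo ha hb hab)
  have h0 := key 0
  have h1 := key 1
  have hxs : a * (‖x 0‖ ^ 2 + ‖x 1‖ ^ 2) ≤ a := mul_le_of_le_one_right ha hx.le
  have hys : b * (‖y 0‖ ^ 2 + ‖y 1‖ ^ 2) ≤ b := mul_le_of_le_one_right hb hy.le
  rcases eq_or_lt_of_le ha with ha' | ha'
  · -- `a = 0`, `b = 1`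
    have hb1 : b = 1 := by linarith
    subst hb1
    subst ha'
    linarith [h0, h1, hy]
  · have hlt : a * (‖x 0‖ ^ 2 + ‖x 1‖ ^ 2) < a := mul_lt_of_lt_one_right ha' hx
    nlinarith [h0, h1, hlt, hys]

/-- The ball is preconnected. -/
theorem isPreconnected_ball : IsPreconnected ball := convex_ball.isPreconnected

namespace TargetData

variable {F E : Type} [Field F] [NumberField F] [IsGalois ℚ F] [IsCMField F]
  [Field E] [NumberField E] [IsGalois ℚ E] [IsCMField E] (d : TargetData F E)

/-- An element of `Γ` is unitary for `H`. -/
theorem isUnitaryOf_of_mem {γ : Matrix (Fin 3) (Fin 3) E} (hγ : γ ∈ d.Γ) : IsUnitaryOf (conjE E) d.H γ :=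
  (d.hΓ.2.2.2.1 hγ).1

/-- The ball matrix of an element of `Γ` lies in `U(2,1)`. -/
theorem toBallMat_mem_U21 {γ : Matrix (Fin 3) (Fin 3) E} (hγ : γ ∈ d.Γ) :
    (toBallMat d.τ₀ d.C γ)ᴴ * J * toBallMat d.τ₀ d.C γ = J :=
  toBallMat_J d.τ₀ (conjE E) (complexConj_intertwines E d.τ₀) d.hC (d.isUnitaryOf_of_mem hγ)

/-- `Γ` preserves the ball. -/
theorem act_mem_ball {γ : Matrix (Fin 3) (Fin 3) E} (hγ : γ ∈ d.Γ) {z : Fin 2 → ℂ} (hz : z ∈ ball) :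
    d.act γ z ∈ ball :=
  actM_mem_ball (d.toBallMat_mem_U21 hγ) hz

/-- The action of an element of `Γ` is holomorphic on the ball. -/
theorem differentiableOn_act {γ : Matrix (Fin 3) (Fin 3) E} (hγ : γ ∈ d.Γ) : DifferentiableOn ℂ (d.act γ) ball :=
  differentiableOn_actM (d.toBallMat_mem_U21 hγ)

/-- The action of an element of `Γ` is differentiable at every point of the ball. -/
theorem differentiableAt_act {γ : Matrix (Fin 3) (Fin 3) E} (hγ : γ ∈ d.Γ) {z : Fin 2 → ℂ} (hz : z ∈ ball) :
    DifferentiableAt ℂ (d.act γ) z :=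
  (d.differentiableOn_act hγ).differentiableAt (isOpen_ball.mem_nhds hz)

end TargetData

end Summit.Ventures.HodgeRepro.Tier4

/-! ## The pairing of `2`-forms over a domain -/

namespace Summit.Ventures.HodgeRepro.Tier4

/-- **The pairing of two `2`-form coefficients over the domain `D`**: `∫_D h · conj k` — the target's own integrand
(`P_T4`: `∫_D jac_s · conj jac_{s̄}`). -/
def pairing2 (D : Set (Fin 2 → ℂ)) (h k : (Fin 2 → ℂ) → ℂ) : ℂ := ∫ z in D, h z * conj (k z)

/-- The pairing is hermitian: `pairing2 D k h = conj (pairing2 D h k)`. -/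
theorem pairing2_conj (D : Set (Fin 2 → ℂ)) (h k : (Fin 2 → ℂ) → ℂ) : pairing2 D k h = conj (pairing2 D h k) := by
  unfold pairing2
  rw [← integral_conj]
  congr 1
  funext z
  simp only [map_mul, Complex.conj_conj]
  ring

/-- The pairing of a `2`-form with itself is real. -/
theorem pairing2_self_im (D : Set (Fin 2 → ℂ)) (h : (Fin 2 → ℂ) → ℂ) : (pairing2 D h h).im = 0 := by
  have := pairing2_conj D h h
  have h2 : (pairing2 D h h).im = -(pairing2 D h h).im := by
    conv_lhs => rw [this]
    simp [Complex.conj_im]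
  linarith

/-- The pairing is linear in the first argument: additivity (for integrable products). -/
theorem pairing2_add_left (D : Set (Fin 2 → ℂ)) (h h' k : (Fin 2 → ℂ) → ℂ)
    (hi : IntegrableOn (fun z => h z * conj (k z)) D) (hi' : IntegrableOn (fun z => h' z * conj (k z)) D) :
    pairing2 D (h + h') k = pairing2 D h k + pairing2 D h' k := by
  unfold pairing2
  simp only [Pi.add_apply, add_mul]
  exact integral_add hi hi'

/-- The pairing is linear in the first argument: homogeneity. -/
theorem pairing2_smul_left (D : Set (Fin 2 → ℂ)) (c : ℂ) (h k : (Fin 2 → ℂ) → ℂ) :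
    pairing2 D (c • h) k = c * pairing2 D h k := by
  unfold pairing2
  simp only [Pi.smul_apply, smul_eq_mul, mul_assoc]
  exact integral_const_mul c _

/-- The pairing is conjugate-linear in the second argument: homogeneity. -/
theorem pairing2_smul_right (D : Set (Fin 2 → ℂ)) (c : ℂ) (h k : (Fin 2 → ℂ) → ℂ) :
    pairing2 D h (c • k) = conj c * pairing2 D h k := by
  unfold pairing2
  simp only [Pi.smul_apply, smul_eq_mul, map_mul]
  rw [← integral_const_mul]
  congr 1
  funext z
  ring

namespace TargetData

variable {F E : Type} [Field F] [NumberField F] [IsGalois ℚ F] [IsCMField F]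
  [Field E] [NumberField E] [IsGalois ℚ E] [IsCMField E] (d : TargetData F E)

/-- The target's pairing is `pairing2` of the two Jacobian coefficients. -/
theorem pairing_eq_pairing2 (D : Set (Fin 2 → ℂ)) (h : Fin 4 → HeckeElement E) :
    d.pairing D h = pairing2 D (d.jacS h) (d.jacSbar h) := rfl

end TargetData

end Summit.Ventures.HodgeRepro.Tier4
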